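import Mathlib
import Summits.QuantumFields.YangMills.Theses.LangevinControlUV

/-!
# Sketch — crux-ideate stmt-QuantumFields-9366 (LatticeGapInUVUnits), round 1, ideator 1

First lemmas of the two idea cards, typed over existing declarations:

* card `knabe-block-sampler`: `KnabeAmplification` (the device, pure operator theory on the
  block 4-torus) and `BlockSamplerCertificate` (the single-scale, β-uniform spectral certificate for
  the block heat-bath sampler of Wilson's measure at block side ⌈K/a(β)⌉).
* card `dyadic-ladder-rate-transport`: `SingleCouplingAnchor`, `LadderRateTransport`, and the
  exact composition `latticeGapInUVUnits_of_anchor_transport` (sorry-free): the crux follows from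
  the two by pure logic, with c₁ = ms / (K · a βs).
-/

namespace Summit.QuantumFields.YangMills.Cruxes.LatticeGapInUVUnits.Ideas

open scoped BigOperators ComplexOrder
open Filter MeasureTheory
open Literature.MathematicalPhysics.QuantumFieldTheory

noncomputable section

/-! ## Card 1 — knabe-block-sampler -/

/-- Sup-adjacency on the discrete 4-torus of block indices (blocks touching, corners included). -/
def TorusAdj {M : ℕ} (x y : Fin 4 → ZMod M) : Prop :=
  ∀ k : Fin 4, ((x k - y k).valMinAbs).natAbs ≤ 1

/-- **Knabe-type local-gap amplification on the block 4-torus** (device of card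
`knabe-block-sampler`; Knabe 1988, Gosset–Mozgunov 2016, Lemm–Mozgunov 2019 for quantum spin
systems — here stated abstractly). There are a threshold sequence `t n → 0` and `c > 0` such that:
for every family of orthogonal projections `Q x` on a complex Hilbert space indexed by the block
torus `(ℤ/M)⁴`, commuting unless the indices are sup-adjacent, if every `n`-patch operator
`A_x = ∑_{y ∈ patch_n(x)} Q y` has gap `≥ γ` above its kernel (`A_x² ≥ γ A_x`), then the global
operator `A = ∑ Q x` has gap `≥ c (γ − t n)` above its kernel. For the heat-bath sampler of a Gibbs
measure, `Q b = 1 − E[· | all links outside block b]` are such projections and "gap above the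
kernel of a patch operator" is the worst (μ-essential) boundary-condition sampler gap. -/
def KnabeAmplification : Prop :=
  ∃ (t : ℕ → ℝ) (c : ℝ), 0 < c ∧ Tendsto t atTop (nhds 0) ∧
    ∀ (M : ℕ) [NeZero M] (H : Type) [NormedAddCommGroup H] [InnerProductSpace ℂ H]
      [CompleteSpace H] (Q : (Fin 4 → ZMod M) → (H →L[ℂ] H)),
      (∀ x, IsSelfAdjoint (Q x) ∧ Q x * Q x = Q x) →
      (∀ x y, ¬ TorusAdj x y → Q x * Q y = Q y * Q x) →
      ∀ (n : ℕ) (γ : ℝ), 2 ≤ n → 4 * n ≤ M → 0 ≤ γ →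
        (∀ x : Fin 4 → ZMod M,
          let A : H →L[ℂ] H :=
            ∑ y ∈ Finset.univ.filter (fun y => ∀ k, ((y k - x k).valMinAbs).natAbs < n), Q y
          (A * A - (γ : ℂ) • A).IsPositive) →
        let A : H →L[ℂ] H := ∑ x, Q x
        (A * A - ((c * (γ - t n) : ℝ) : ℂ) • A).IsPositive

/-- σ-algebra generated by the link variables in a set `S` of edges of the torus of side `L`. -/
@[reducible] def linkSigma {G : Type} [MeasurableSpace G] {L : ℕ} (S : Set (Edge 4 L)) :
    MeasurableSpace (GaugeConfig 4 L G) :=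
  MeasurableSpace.comap (fun (U : GaugeConfig 4 L G) (e : S) => U e.1) MeasurableSpace.pi

/-- Block index (integer division of each coordinate by the block side `b`) of a site of the torus
of side `L = m·b`, read in `(ℤ/m)⁴`. -/
def blockOf {L : ℕ} (m b : ℕ) (x : Site 4 L) : Fin 4 → ZMod m :=
  fun k => (((x k).val / b : ℕ) : ZMod m)

/-- **Block-sampler certificate at the femto-pinned scale** (the open, β-uniform single-scale
content of card `knabe-block-sampler`). For every compact simple `G`, faithful unitary `r` and unit
map `a` there are `K, γ > 0`, `n₀ ≥ 2` and `β₂` such that for all `β ≥ β₂`, on every torus of side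
`L = m·b` with block side `b = ⌈K/a(β)⌉` and `m ≥ 4n₀` blocks per direction, Wilson's measure `μ`
satisfies the LOCAL POINCARÉ INEQUALITY FOR THE BLOCK HEAT-BATH SAMPLER on every `n₀`-patch `P`
of blocks, relative to the exterior σ-algebra:
`∫ (F − μ[F | links outside P])² dμ ≤ γ⁻¹ ∑_{blocks w ⊂ P} ∫ (F − μ[F | links outside w])² dμ`
for all bounded measurable GAUGE-INVARIANT `F` — i.e. the patch operator `∑_{w⊂P}(1 − E_w)`
restricted to the gauge-invariant subspace has gap `≥ γ` above its kernel (worst μ-typical boundary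
condition). On the full `L²(μ)` the patch gap is `O(1/β)` (interface links of one block are pinned,
non-gauge-invariantly, by the neighbouring block's links through `U_p ≈ 1`), so the restriction is
essential. Used with `γ > t n₀` of `KnabeAmplification` (all operators commute with the gauge
action, so Knabe runs on the invariant subspace). -/
def BlockSamplerCertificate : Prop :=
  ∀ (G : Type) [Group G] [TopologicalSpace G] [IsTopologicalGroup G] [CompactSpace G],
    IsCompactSimpleLieGroup G → letI : MeasurableSpace G := borel G; haveI : BorelSpace G := ⟨rfl⟩;
    ∀ (r : LatticeRep G) (a : ℝ → ℝ), (∀ β, 0 < a β) → Tendsto a atTop (nhds 0) →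
    ∃ (K γ β₂ : ℝ) (n₀ : ℕ), 0 < K ∧ 0 < γ ∧ 2 ≤ n₀ ∧
      ∀ (β : ℝ), β₂ ≤ β → ∀ (m b L : ℕ) [NeZero m] [NeZero L],
        b = ⌈K / a β⌉₊ → L = m * b → 4 * n₀ ≤ m →
        let μ : Measure (GaugeConfig 4 L G) := wilsonMeasure (d := 4) (L := L) r.ρ β
        ∀ (z : Fin 4 → ZMod m) (F : GaugeConfig 4 L G → ℝ), Measurable F → (∃ B : ℝ, ∀ U, |F U| ≤ B) →
          IsGaugeInvariant F →
          let inPatch : Site 4 L → Prop :=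
            fun x => ∀ k, (((blockOf m b x) k - z k).valMinAbs).natAbs < n₀
          let mExt : MeasurableSpace (GaugeConfig 4 L G) := linkSigma {e | ¬ inPatch e.1}
          let mBlk : (Fin 4 → ZMod m) → MeasurableSpace (GaugeConfig 4 L G) :=
            fun w => linkSigma {e | blockOf m b e.1 ≠ w}
          ∫ U, (F U - (μ[F|mExt]) U) ^ 2 ∂μ ≤
            γ⁻¹ * ∑ w ∈ Finset.univ.filter (fun w : Fin 4 → ZMod m =>
                ∀ k, ((w k - z k).valMinAbs).natAbs < n₀),
              ∫ U, (F U - (μ[F|mBlk w]) U) ^ 2 ∂μ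

/-! ## Card 2 — dyadic-ladder-rate-transport -/

/-- **Single-coupling anchor**: beyond any prescribed `β₁` there is ONE coupling `βs` at which
Wilson's theory clusters volume-uniformly at some rate `ms > 0` (lattice units) for all pairs of
gauge-invariant local observables, on all tori of side `2S+1 ≥ 2Ts+1`. -/
def SingleCouplingAnchor : Prop :=
  ∀ (G : Type) [Group G] [TopologicalSpace G] [IsTopologicalGroup G] [CompactSpace G],
    IsCompactSimpleLieGroup G → letI : MeasurableSpace G := borel G; haveI : BorelSpace G := ⟨rfl⟩;
    ∀ (r : LatticeRep G) (β₁ : ℝ), ∃ (βs ms : ℝ) (Ts : ℕ), β₁ ≤ βs ∧ 0 < ms ∧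
      ∀ A B : YMSpecies G, ∃ C : ℝ, ∀ S n : ℕ, Ts ≤ S → n ≤ S →
        |latticeConnectedCorr r.ρ βs (2 * S + 1) A.F B.F n| ≤ C * Real.exp (-(ms * n))

/-- **Rate transport along the femto ladder** (the lever of card `dyadic-ladder-rate-transport`):
for every unit map `a` carrying the femto two-point package there are `K > 0`, `β₁` and volume
thresholds `S₁` such that exponential clustering of a pair `(A, B)` at coupling `β ≥ β₁` with rate
`m` transports to every `β' ≥ β` with rate `m · a(β') / (K · a(β))` and prefactor `D(A,B) · C`,
uniformly in `β'` — exact covariance of decay rates under `a(β)/a(β')`-blocking, up to ONE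
universality constant `K` (no accumulation along the ladder). -/
def LadderRateTransport : Prop :=
  ∀ (G : Type) [Group G] [TopologicalSpace G] [IsTopologicalGroup G] [CompactSpace G],
    IsCompactSimpleLieGroup G → letI : MeasurableSpace G := borel G; haveI : BorelSpace G := ⟨rfl⟩;
    ∀ (r : LatticeRep G), ∀ (a : ℝ → ℝ), (∃ (Γ : ℝ → ℝ) (β₀ ℓ₀ c C : ℝ), 0 < ℓ₀ ∧ 0 < c ∧ (∀ β, 0 < a β) ∧ Filter.Tendsto a Filter.atTop (nhds 0) ∧ (∀ s : ℝ, 0 < s → s ≤ ℓ₀ → 0 < Γ s ∧ Γ s ≤ 1) ∧ ∀ (L : ℕ) [NeZero L] (β : ℝ), β₀ ≤ β → (L : ℝ) * a β ≤ ℓ₀ → let P : (Fin 4 → ZMod L) → Fin 4 → Fin 4 → GaugeConfig 4 L G → ℝ := fun x i j U => (r.N : ℝ) - (r.ρ (plaquetteHolonomy U x i j)).trace.re; let E : (GaugeConfig 4 L G → ℝ) → ℝ := fun F => wilsonExpectation (d := 4) (L := L) r.ρ β F; let cov : (GaugeConfig 4 L G → ℝ) → (GaugeConfig 4 L G → ℝ)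 → ℝ := fun F F' => E (fun U => F U * F' U) - E F * E F'; let dist : (Fin 4 → ZMod L) → (Fin 4 → ZMod L) → ℝ := fun x y => Real.sqrt (∑ k : Fin 4, (((x k - y k).valMinAbs : ℤ) : ℝ) ^ 2); (∀ n : ℕ, 1 ≤ n → 8 * n ≤ L → c * Γ ((n : ℝ) * a β) ≤ (n : ℝ) ^ 8 * cov (P 0 0 1) (P (Pi.single (2 : Fin 4) ((n : ℕ) : ZMod L)) 0 1) ∧ (n : ℝ) ^ 8 * cov (P 0 0 1) (P (Pi.single (2 : Fin 4) ((n : ℕ) : ZMod L)) 0 1) ≤ C * Γ ((n : ℝ) * a β)) ∧ (∀ (x y : Fin 4 → ZMod L) (i j i' j' : Fin 4), x ≠ y → i ≠ j → i' ≠ j' → |cov (P x i j) (P y i' j')| * dist x y ^ 8 ≤ C * Γ (dist x y * a β))) →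
    ∃ (K β₁ : ℝ) (S₁ : ℝ → ℕ), 0 < K ∧ ∀ A B : YMSpecies G, ∃ D : ℝ, ∀ (β : ℝ), β₁ ≤ β →
      ∀ (m C : ℝ) (T : ℕ), 0 < m →
        (∀ S n : ℕ, T ≤ S → n ≤ S →
          |latticeConnectedCorr r.ρ β (2 * S + 1) A.F B.F n| ≤ C * Real.exp (-(m * n))) →
        ∀ (β' : ℝ), β ≤ β' → ∀ S n : ℕ, T ≤ S → S₁ β' ≤ S → n ≤ S →
          |latticeConnectedCorr r.ρ β' (2 * S + 1) A.F B.F n| ≤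
            D * C * Real.exp (-(m * a β' / (K * a β) * n))

/-- **Exact transfer**: the crux follows from the anchor and the ladder transport by pure logic,
with `c₁ = ms / (K · a βs)`, `β₂ = βs`, `S₁' β = max Ts (S₁ β)`. -/
theorem latticeGapInUVUnits_of_anchor_transport
    (hA : SingleCouplingAnchor) (hT : LadderRateTransport) :
    Summit.QuantumFields.YangMills.Theses.LangevinControlUV.LatticeGapInUVUnits := by
  intro G _ _ _ _ hG
  dsimp only
  intro r a hpkg
  obtain ⟨K, β₁, S₁, hK, hTr⟩ := hT G hG r a hpkg
  obtain ⟨βs, ms, Ts, hβ, hm, hAn⟩ := hA G hG r β₁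
  obtain ⟨Γ, β₀, ℓ₀, c, C, -, -, ha, -⟩ := hpkg
  refine ⟨ms / (K * a βs), βs, fun β => max Ts (S₁ β), div_pos hm (mul_pos hK (ha βs)), ?_⟩
  intro A B
  obtain ⟨D, hD⟩ := hTr A B
  obtain ⟨C₀, hC₀⟩ := hAn A B
  refine ⟨D * C₀, ?_⟩
  intro β' hβ' S n hS hn
  have h := hD βs hβ ms C₀ Ts hm (fun S n hS hn => hC₀ S n hS hn) β' hβ' S n
    (le_of_max_le_left hS) (le_of_max_le_right hS) hn
  have hexp : ms * a β' / (K * a βs) * (n : ℝ) = ms / (K * a βs) * a β' * (n : ℝ) := by ring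
  rw [hexp] at h
  exact h

end

end Summit.QuantumFields.YangMills.Cruxes.LatticeGapInUVUnits.Ideas
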